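import Summits.MatrixMultiplication.OmegaCensus.VertexCountingGap12
import Summits.MatrixMultiplication.OmegaCensus.DihedralLikeVertexCounting
import HarnessLib

/-!
# The shapes at slack `20` (`|A| ≡ 1 (mod 3)`, volume `law − 4`)

ω-census, family (b3).  Framing: lottery ticket; floor = certified bounds/negative ranges.

Companion of `VertexCountingModOneShape.lean` (slack `8` = the mod-one law).  For `N ≡ 1 (mod 3)` the dihedral-like
law is `V = (8N − 8)/3`; by `VertexCountingGap12.lean` the next possible volume is `law − 4 = (8N − 20)/3`, total slack
`8N − 3V = 20`, and then two part pairs are balanced.  Here (`sub_four_shape_of_vertex_bounds`, `V ≥ 127`): with the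
balanced pairs `(d,d), (e,e)` and the third pair `(x, y)`, the two vertex constraints `de(2x + y) ≤ N`,
`de(x + 2y) ≤ N` and `12·de(x+y) + 20 = 8N` force `de·|x − y| ≤ 5` and `de(x+y)` odd, i.e. exactly one of

* **P1** `de = 1`, `|x − y| ∈ {1, 3, 5}` — two dominoes and a big set, `N = (3(x+y) + 5)/2`;
* **P3** `de = 3`, `|x − y| = 1` — `(c+1, c | 1,1 | 3,3)`, `N = 9c + 7`;
* **P5** `de = 5`, `|x − y| = 1` — `(c+1, c | 1,1 | 5,5)`, `N = 15c + 10`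

(up to the roles of the three sets).  `mod_one_sub_four_shape` is the same statement for an actual TPP triple of a
dihedral-like group with `|A| ≥ 52`.  Use (`DihedralLikeLawGap12.lean`): in dicyclic type the P1 triples saturate to law
triples, so `A/⟨c₀⟩` non-cyclic leaves only P3/P5, which need `N ≡ 7 (mod 9)` resp. `N ≡ 10 (mod 15)`.
-/

namespace Summit.MatrixMultiplication.OmegaCensus

open Literature.Combinatorics.Additive Finset

/-- Core of the slack-`20` shape: `y < x`, `2xP + yP ≤ N`, `12(xP + yP) + 20 = 8N`, `P ≠ 0` give
`P = 1 ∧ x − y ∈ {1,3,5}` or `P ∈ {3,5} ∧ x = y + 1`. [folklore] -/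
theorem sub_four_shape_core {x y P N : ℕ} (hlt : y < x) (hP : P ≠ 0)
    (k1 : 2 * (x * P) + y * P ≤ N) (k3 : 12 * (x * P) + 12 * (y * P) + 20 = 8 * N) :
    (P = 1 ∧ (x = y + 1 ∨ x = y + 3 ∨ x = y + 5)) ∨ ((P = 3 ∨ P = 5) ∧ x = y + 1) := by
  have hP0 : 0 < P := Nat.pos_of_ne_zero hP
  have hyx : y * P < x * P := Nat.mul_lt_mul_of_lt_of_le hlt le_rfl hP0
  have hd : P ∣ x * P - y * P := Nat.dvd_sub (dvd_mul_left P x) (dvd_mul_left P y)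
  have h5 : x * P - y * P ≤ 5 := by omega
  have hPle : P ≤ 5 := le_trans (Nat.le_of_dvd (by omega) hd) h5
  interval_cases P <;> omega

/-- **The shapes at slack `20`** (pure arithmetic; `V ≥ 127`). [folklore] -/
theorem sub_four_shape_of_vertex_bounds (N s₀ s₁ t₀ t₁ u₀ u₁ : ℕ)
    (h000 : s₁ * t₀ * u₀ + s₀ * t₁ * u₀ + s₀ * t₀ * u₁ ≤ N) (h111 : s₀ * t₁ * u₁ + s₁ * t₀ * u₁ + s₁ * t₁ * u₀ ≤ N)
    (h100 : s₀ * t₀ * u₀ + s₁ * t₁ * u₀ + s₁ * t₀ * u₁ ≤ N) (h011 : s₁ * t₁ * u₁ + s₀ * t₀ * u₁ + s₀ * t₁ * u₀ ≤ N)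
    (h010 : s₁ * t₁ * u₀ + s₀ * t₀ * u₀ + s₀ * t₁ * u₁ ≤ N) (h101 : s₀ * t₀ * u₁ + s₁ * t₁ * u₁ + s₁ * t₀ * u₀ ≤ N)
    (h001 : s₁ * t₀ * u₁ + s₀ * t₁ * u₁ + s₀ * t₀ * u₀ ≤ N) (h110 : s₀ * t₁ * u₀ + s₁ * t₀ * u₀ + s₁ * t₁ * u₁ ≤ N)
    (hV : 127 ≤ (s₀ + s₁) * (t₀ + t₁) * (u₀ + u₁)) (h20 : 3 * ((s₀ + s₁) * (t₀ + t₁) * (u₀ + u₁)) + 20 = 8 * N) :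
    (t₀ = t₁ ∧ u₀ = u₁ ∧ ((t₀ * u₀ = 1 ∧ (s₀ = s₁ + 1 ∨ s₀ = s₁ + 3 ∨ s₀ = s₁ + 5 ∨ s₁ = s₀ + 1 ∨ s₁ = s₀ + 3 ∨ s₁ = s₀ + 5))
      ∨ ((t₀ * u₀ = 3 ∨ t₀ * u₀ = 5) ∧ (s₀ = s₁ + 1 ∨ s₁ = s₀ + 1)))) ∨
    (s₀ = s₁ ∧ u₀ = u₁ ∧ ((s₀ * u₀ = 1 ∧ (t₀ = t₁ + 1 ∨ t₀ = t₁ + 3 ∨ t₀ = t₁ + 5 ∨ t₁ = t₀ + 1 ∨ t₁ = t₀ + 3 ∨ t₁ = t₀ + 5))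
      ∨ ((s₀ * u₀ = 3 ∨ s₀ * u₀ = 5) ∧ (t₀ = t₁ + 1 ∨ t₁ = t₀ + 1)))) ∨
    (s₀ = s₁ ∧ t₀ = t₁ ∧ ((s₀ * t₀ = 1 ∧ (u₀ = u₁ + 1 ∨ u₀ = u₁ + 3 ∨ u₀ = u₁ + 5 ∨ u₁ = u₀ + 1 ∨ u₁ = u₀ + 3 ∨ u₁ = u₀ + 5))
      ∨ ((s₀ * t₀ = 3 ∨ s₀ * t₀ = 5) ∧ (u₀ = u₁ + 1 ∨ u₁ = u₀ + 1)))) := by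
  have hD : 8 * N ≤ 3 * ((s₀ + s₁) * (t₀ + t₁) * (u₀ + u₁)) + 31 := by omega
  rcases two_balanced_of_vertex_bounds31 N s₀ s₁ t₀ t₁ u₀ u₁ h000 h111 h100 h011 h010 h101 h001 h110 hV hD with
    ⟨hs, ht⟩ | ⟨hs, hu⟩ | ⟨ht, hu⟩
  · -- `s`, `t` balanced: `U` is the odd one
    right; right
    subst hs; subst ht
    refine ⟨rfl, rfl, ?_⟩
    have hP : s₀ * t₀ ≠ 0 := by
      intro h0
      have e : (s₀ + s₀) * (t₀ + t₀) * (u₀ + u₁) = 4 * (s₀ * t₀) * (u₀ + u₁) := by ring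
      rw [e, h0] at hV; omega
    have hne : u₀ ≠ u₁ := by
      rintro rfl
      have e : (s₀ + s₀) * (t₀ + t₀) * (u₀ + u₀) = 8 * (s₀ * t₀ * u₀) := by ring
      rw [e] at h20; omega
    rcases Nat.lt_or_gt_of_ne hne with hlt | hlt
    · rcases sub_four_shape_core (N := N) hlt hP (by linarith) (by linarith) with ⟨h1, h2⟩ | ⟨h1, h2⟩
      · exact Or.inl ⟨h1, by omega⟩
      · exact Or.inr ⟨h1, Or.inr h2⟩
    · rcases sub_four_shape_core (N := N) hlt hP (by linarith) (by linarith) with ⟨h1, h2⟩ | ⟨h1, h2⟩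
      · exact Or.inl ⟨h1, by omega⟩
      · exact Or.inr ⟨h1, Or.inl h2⟩
  · -- `s`, `u` balanced: `T` is the odd one
    right; left
    subst hs; subst hu
    refine ⟨rfl, rfl, ?_⟩
    have hP : s₀ * u₀ ≠ 0 := by
      intro h0
      have e : (s₀ + s₀) * (t₀ + t₁) * (u₀ + u₀) = 4 * (s₀ * u₀) * (t₀ + t₁) := by ring
      rw [e, h0] at hV; omega
    have hne : t₀ ≠ t₁ := by
      rintro rfl
      have e : (s₀ + s₀) * (t₀ + t₀) * (u₀ + u₀) = 8 * (s₀ * t₀ * u₀) := by ring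
      rw [e] at h20; omega
    rcases Nat.lt_or_gt_of_ne hne with hlt | hlt
    · rcases sub_four_shape_core (N := N) hlt hP (by linarith) (by linarith) with ⟨h1, h2⟩ | ⟨h1, h2⟩
      · exact Or.inl ⟨h1, by omega⟩
      · exact Or.inr ⟨h1, Or.inr h2⟩
    · rcases sub_four_shape_core (N := N) hlt hP (by linarith) (by linarith) with ⟨h1, h2⟩ | ⟨h1, h2⟩
      · exact Or.inl ⟨h1, by omega⟩
      · exact Or.inr ⟨h1, Or.inl h2⟩
  · -- `t`, `u` balanced: `S` is the odd one
    left
    subst ht; subst hu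
    refine ⟨rfl, rfl, ?_⟩
    have hP : t₀ * u₀ ≠ 0 := by
      intro h0
      have e : (s₀ + s₁) * (t₀ + t₀) * (u₀ + u₀) = 4 * (t₀ * u₀) * (s₀ + s₁) := by ring
      rw [e, h0] at hV; omega
    have hne : s₀ ≠ s₁ := by
      rintro rfl
      have e : (s₀ + s₀) * (t₀ + t₀) * (u₀ + u₀) = 8 * (s₀ * t₀ * u₀) := by ring
      rw [e] at h20; omega
    rcases Nat.lt_or_gt_of_ne hne with hlt | hlt
    · rcases sub_four_shape_core (N := N) hlt hP (by linarith) (by linarith) with ⟨h1, h2⟩ | ⟨h1, h2⟩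
      · exact Or.inl ⟨h1, by omega⟩
      · exact Or.inr ⟨h1, Or.inr h2⟩
    · rcases sub_four_shape_core (N := N) hlt hP (by linarith) (by linarith) with ⟨h1, h2⟩ | ⟨h1, h2⟩
      · exact Or.inl ⟨h1, by omega⟩
      · exact Or.inr ⟨h1, Or.inl h2⟩

section DihedralLike

variable {A : Type*} [AddCommGroup A] [DecidableEq A] [Fintype A] {G : Type} [Group G] [DecidableEq G]
  {ρ τ : A → G} {c₀ : A} {S T U : Finset G}

/-- **The shapes of a `law − 4` triple at `|A| ≡ 1 (mod 3)`** (`|A| ≥ 52`, any `c₀`): a TPP triple of a dihedral-like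
group with `3|S||T||U| + 20 = 8|A|` has coset part sizes of shape P1, P3 or P5 as in
`sub_four_shape_of_vertex_bounds`. [folklore] -/
theorem mod_one_sub_four_shape
    (hρρ : ∀ a b, ρ a * ρ b = ρ (a + b)) (hρτ : ∀ a b, ρ a * τ b = τ (b - a))
    (hτρ : ∀ a b, τ a * ρ b = τ (a + b)) (hττ : ∀ a b, τ a * τ b = ρ (c₀ + b - a))
    (hρ : Function.Injective ρ) (hτ : Function.Injective τ) (hne : ∀ a b, ρ a ≠ τ b)
    (hsurj : ∀ g, (∃ a, ρ a = g) ∨ (∃ a, τ a = g)) (hA : 52 ≤ Fintype.card A) (h : TripleProductProperty S T U)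
    (hV : 3 * (S.card * T.card * U.card) + 20 = 8 * Fintype.card A) :
    let s₀ := (univ.filter fun a : A => ρ a ∈ S).card
    let s₁ := (univ.filter fun a : A => τ a ∈ S).card
    let t₀ := (univ.filter fun a : A => ρ a ∈ T).card
    let t₁ := (univ.filter fun a : A => τ a ∈ T).card
    let u₀ := (univ.filter fun a : A => ρ a ∈ U).card
    let u₁ := (univ.filter fun a : A => τ a ∈ U).card
    (t₀ = t₁ ∧ u₀ = u₁ ∧ ((t₀ * u₀ = 1 ∧ (s₀ = s₁ + 1 ∨ s₀ = s₁ + 3 ∨ s₀ = s₁ + 5 ∨ s₁ = s₀ + 1 ∨ s₁ = s₀ + 3 ∨ s₁ = s₀ + 5))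
      ∨ ((t₀ * u₀ = 3 ∨ t₀ * u₀ = 5) ∧ (s₀ = s₁ + 1 ∨ s₁ = s₀ + 1)))) ∨
    (s₀ = s₁ ∧ u₀ = u₁ ∧ ((s₀ * u₀ = 1 ∧ (t₀ = t₁ + 1 ∨ t₀ = t₁ + 3 ∨ t₀ = t₁ + 5 ∨ t₁ = t₀ + 1 ∨ t₁ = t₀ + 3 ∨ t₁ = t₀ + 5))
      ∨ ((s₀ * u₀ = 3 ∨ s₀ * u₀ = 5) ∧ (t₀ = t₁ + 1 ∨ t₁ = t₀ + 1)))) ∨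
    (s₀ = s₁ ∧ t₀ = t₁ ∧ ((s₀ * t₀ = 1 ∧ (u₀ = u₁ + 1 ∨ u₀ = u₁ + 3 ∨ u₀ = u₁ + 5 ∨ u₁ = u₀ + 1 ∨ u₁ = u₀ + 3 ∨ u₁ = u₀ + 5))
      ∨ ((s₀ * t₀ = 3 ∨ s₀ * t₀ = 5) ∧ (u₀ = u₁ + 1 ∨ u₁ = u₀ + 1)))) := by
  intro s₀ s₁ t₀ t₁ u₀ u₁
  obtain ⟨h000, h111, h100, h011, h010, h101, h001, h110⟩ := vertex_counting' hρρ hρτ hτρ hττ hρ hτ hne h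
  rw [card_eq_parts' hρ hτ hne hsurj S, card_eq_parts' hρ hτ hne hsurj T, card_eq_parts' hρ hτ hne hsurj U] at hV
  exact sub_four_shape_of_vertex_bounds (Fintype.card A) s₀ s₁ t₀ t₁ u₀ u₁ h000 h111 h100 h011 h010 h101 h001 h110
    (by simp only [s₀, s₁, t₀, t₁, u₀, u₁]; omega) hV

end DihedralLike

end Summit.MatrixMultiplication.OmegaCensus
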